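import Literature.NumberTheory.DiophantineApproximation.PadicSubspaceTheorem
import Mathlib.LinearAlgebra.Matrix.NonsingularInverse
import Mathlib.LinearAlgebra.Basis.VectorSpace
import HarnessLib

/-!
# The `p`-adic Subspace Theorem over `ℚ` for integer points — proved consequences of the named fact

Companion to `PadicSubspaceTheorem.lean` (the named fact `Schlickewei1976_padicSubspaceTheorem` =
Bilu, Sém. Bourbaki 967, Thm. 2.3, as printed; a theorem in print, NOT proved in the tree).  THEOREMS
ONLY (no definition, no named fact, no `sorry`): three consequences, each taking the fact as a
hypothesis `(h : Schlickewei1976_padicSubspaceTheorem)`.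

* `Schlickewei1976_padicSubspaceTheorem.hyperplanes` — the theorem with its conclusion in the
  HYPERPLANE FORM used in the tree: a finite set `T` of NON-ZERO rational linear forms, one of which
  vanishes at each non-zero integer solution (every proper subspace of `ℚ^m` lies in a rational
  hyperplane; the shape of the rational-coefficient hypothesis `hST` of
  `Literature.NumberTheory.DiophantineGeometry.BugeaudCorvajaZannier2003_thm1_of_subspaceTheorem`).
* `Schlickewei1976_padicSubspaceTheorem.integerPoints_real_prime` — the case `S = {∞, p}` with REAL
  algebraic coefficients at `∞` and `ε = 1/q`, in the multiplicative shape
  `((∏_i |L_i(x)|)(∏_i |M_i(x)|_p))^q · ‖x‖ < 1`: VERBATIM the binder `PadicSubspace` of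
  `Summits/Schanuel/Schanuel/Theorems/RootDecomp1KSubspaceBranch01.lean` (ledger cite item wi-102433),
  so that `h.integerPoints_real_prime : PadicSubspace`.
* `Schlickewei1976_padicSubspaceTheorem.schmidt` — the case `S = {∞}`: Schmidt's Subspace Theorem in
  the shape of Bilu Thm. 2.2 / Evertse–Győry Thm. 3.1.2 (complex algebraic coefficients, hyperplane form).

Private helpers: a proper subspace of `ℚ^m` lies in a rational hyperplane (`Submodule.exists_le_ker_of_lt_top`);
`‖x‖ ≥ 1` for `x ∈ ℤ^m ∖ {0}`; linear independence of real rows survives complexification (`det`).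

## References

* [Bilu2008] Yu. F. Bilu, *The many faces of the subspace theorem*, Sém. Bourbaki Exp. 967,
  Astérisque **317** (2008) 1–38 — Thm. 2.2, Thm. 2.3 (p. 967-04).
* [BombieriGubler2006] E. Bombieri, W. Gubler, *Heights in Diophantine Geometry*, CUP 2006 —
  Thm. 7.2.2, Rem. 7.2.3, Cor. 7.2.5 (pp. 177–178; PDF pp. 172–173).
* [EvertseGyory2015] J.-H. Evertse, K. Győry, *Unit Equations in Diophantine Number Theory*,
  CUP 2015 — Thm. 3.1.2, Thm. 3.1.3 (PDF pp. 50–52).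
-/

noncomputable section

open Finset

namespace Literature.NumberTheory.DiophantineApproximation

/-- A proper linear subspace of `ℚ^m` is contained in a rational hyperplane: there is `c ≠ 0` in `ℚ^m`
with `∑_j c_j x_j = 0` for all `x` in the subspace. [folklore] -/
private theorem exists_ne_zero_forall_sum_mul_eq_zero_of_ne_top {m : ℕ} (V : Submodule ℚ (Fin m → ℚ))
    (hV : V ≠ ⊤) : ∃ c : Fin m → ℚ, c ≠ 0 ∧ ∀ x ∈ V, ∑ j, c j * x j = 0 := by
  obtain ⟨f, hf0, hle⟩ := V.exists_le_ker_of_lt_top (lt_top_iff_ne_top.2 hV)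
  refine ⟨fun i => f (fun j => if i = j then 1 else 0), ?_, ?_⟩
  · intro hc
    apply hf0
    refine LinearMap.ext fun x => ?_
    rw [LinearMap.pi_apply_eq_sum_univ f x, LinearMap.zero_apply]
    refine Finset.sum_eq_zero fun i _ => ?_
    have hi := congr_fun hc i
    simp only [Pi.zero_apply] at hi
    rw [hi, smul_zero]
  · intro x hx
    have h0 : f x = 0 := LinearMap.mem_ker.1 (hle hx)
    rw [LinearMap.pi_apply_eq_sum_univ f x] at h0
    simpa [smul_eq_mul, mul_comm] using h0

/-- **Hyperplane form** of `Schlickewei1976_padicSubspaceTheorem`: under the same hypotheses there is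
a finite set `T` of NON-ZERO rational linear forms such that every non-zero integer solution `x` of
`∏_{p∈S} ∏_i |L_{i,p}(x)|_p ≤ ‖x‖^{-ε}` satisfies `∑_j f_j x_j = 0` for some `f ∈ T` (each proper
subspace of `ℚ^m` lies in a rational hyperplane). This is the shape of the tree's rational-coefficient
hypothesis `hST` of `BugeaudCorvajaZannier2003_thm1_of_subspaceTheorem`.
[cite: Bilu2008, Thm. 2.3 (p. 967-04)] -/
theorem Schlickewei1976_padicSubspaceTheorem.hyperplanes (h : Schlickewei1976_padicSubspaceTheorem) :
    ∀ (m : ℕ), 2 ≤ m →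
    ∀ (ι : Type) [Fintype ι] (p : ι → ℕ) [∀ k, Fact (p k).Prime], Function.Injective p →
    ∀ (L : Fin m → Fin m → ℂ), (∀ i j, IsAlgebraic ℚ (L i j)) → LinearIndependent ℂ L →
    ∀ (M : (k : ι) → Fin m → Fin m → PadicAlgCl (p k)),
      (∀ k i j, IsAlgebraic ℚ (M k i j)) → (∀ k, LinearIndependent (PadicAlgCl (p k)) (M k)) →
    ∀ ε : ℝ, 0 < ε →
      ∃ T : Finset (Fin m → ℚ), (∀ f ∈ T, f ≠ 0) ∧
        ∀ x : Fin m → ℤ, x ≠ 0 →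
          (∏ i, ‖∑ j, L i j * (x j : ℂ)‖) * (∏ k, ∏ i, ‖∑ j, M k i j * (x j : PadicAlgCl (p k))‖) ≤
              (((Finset.univ.sup fun j => (x j).natAbs : ℕ) : ℝ)) ^ (-ε) →
          ∃ f ∈ T, ∑ j, f j * (x j : ℚ) = 0 := by
  intro m hm ι _ p _ hp L hLa hLi M hMa hMi ε hε
  classical
  obtain ⟨T, hT, hsol⟩ := h m hm ι p hp L hLa hLi M hMa hMi ε hε
  -- a non-zero rational linear form vanishing on each `V ∈ T`
  have hc : ∀ V : T, ∃ c : Fin m → ℚ, c ≠ 0 ∧ ∀ x ∈ (V : Submodule ℚ (Fin m → ℚ)), ∑ j, c j * x j = 0 :=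
    fun V => exists_ne_zero_forall_sum_mul_eq_zero_of_ne_top V.1 (hT V.1 V.2)
  choose c hc0 hcV using hc
  refine ⟨Finset.univ.image c, ?_, ?_⟩
  · intro f hf
    obtain ⟨V, -, rfl⟩ := Finset.mem_image.1 hf
    exact hc0 V
  · intro x hx hineq
    obtain ⟨V, hVT, hxV⟩ := hsol x hx hineq
    exact ⟨c ⟨V, hVT⟩, Finset.mem_image_of_mem _ (Finset.mem_univ _), hcV ⟨V, hVT⟩ _ hxV⟩

/-- The sup-norm `‖x‖ = max_j |x_j|` of a non-zero integer vector is `≥ 1`. [folklore] -/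
private theorem one_le_sup_natAbs_of_ne_zero {m : ℕ} {x : Fin m → ℤ} (hx : x ≠ 0) :
    (1 : ℝ) ≤ ((Finset.univ.sup fun j => (x j).natAbs : ℕ) : ℝ) := by
  obtain ⟨j, hj⟩ := Function.ne_iff.1 hx
  have h1 : 1 ≤ (x j).natAbs := Nat.one_le_iff_ne_zero.2 (Int.natAbs_ne_zero.2 hj)
  have h2 : (x j).natAbs ≤ Finset.univ.sup fun j => (x j).natAbs :=
    Finset.le_sup (f := fun j => (x j).natAbs) (Finset.mem_univ j)
  exact_mod_cast h1.trans h2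

/-- Linear independence of the rows of a real square matrix survives complexification
(`det ≠ 0` is preserved by the injection `ℝ → ℂ`). [folklore] -/
private theorem linearIndependent_complex_of_real {m : ℕ} {L : Fin m → Fin m → ℝ} (hL : LinearIndependent ℝ L) :
    LinearIndependent ℂ (fun i j => (L i j : ℂ)) := by
  have h1 : IsUnit (Matrix.of L) := (Matrix.linearIndependent_rows_iff_isUnit (A := Matrix.of L)).1 hL
  rw [Matrix.isUnit_iff_isUnit_det] at h1
  have h3 : Matrix.of (fun i j => (L i j : ℂ)) = Complex.ofRealHom.mapMatrix (Matrix.of L) := by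
    ext i j; rfl
  have h2 : IsUnit (Matrix.of (fun i j => (L i j : ℂ))) := by
    rw [Matrix.isUnit_iff_isUnit_det, h3, ← RingHom.map_det, isUnit_iff_ne_zero, Complex.ofRealHom_eq_coe,
      Complex.ofReal_ne_zero]
    exact h1.ne_zero
  exact (Matrix.linearIndependent_rows_iff_isUnit (A := Matrix.of (fun i j => (L i j : ℂ)))).2 h2

/-- **The case `S = {∞, p}` with real algebraic coefficients and `ε = 1/q`** — VERBATIM the binder
`PadicSubspace` of the Schanuel cell (lens-1 g52, `RootDecomp1KSubspaceBranch01`): for `n ≥ 2`, a prime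
`p`, `n` linearly independent real linear forms `L_i` with real algebraic coefficients, `n` linearly
independent linear forms `M_i` with coefficients in `\overline{ℚ_p}` algebraic over `ℚ`, and `q ≥ 1`,
there is a finite set `T` of non-zero rational linear forms such that every `x ∈ ℤ^n ∖ {0}` with
`((∏_i |L_i(x)|)·(∏_i |M_i(x)|_p))^q · ‖x‖ < 1` (that is `∏∏ < ‖x‖^{-1/q}`) satisfies `f(x) = 0` for
some `f ∈ T`.  From `Schlickewei1976_padicSubspaceTheorem` with `S = {∞, p}`, the real forms read in `ℂ`,
and `ε = 1/q` (`P^q·‖x‖ < 1`, `‖x‖ ≥ 1` `⇒` `P < ‖x‖^{-1/q}`).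
[cite: Bilu2008, Thm. 2.3 (p. 967-04)] [cite: BombieriGubler2006, Thm. 7.2.2, Rem. 7.2.3, Cor. 7.2.5 (pp. 177–178)] -/
theorem Schlickewei1976_padicSubspaceTheorem.integerPoints_real_prime
    (h : Schlickewei1976_padicSubspaceTheorem) :
    ∀ (n : ℕ), 2 ≤ n → ∀ (p : ℕ) [Fact p.Prime] (L : Fin n → Fin n → ℝ) (M : Fin n → Fin n → PadicAlgCl p),
    (∀ i j, IsAlgebraic ℚ (L i j)) → (∀ i j, IsAlgebraic ℚ (M i j)) →
    LinearIndependent ℝ L → LinearIndependent (PadicAlgCl p) M →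
    ∀ q : ℕ, 1 ≤ q →
      ∃ T : Finset (Fin n → ℚ), (∀ f ∈ T, f ≠ 0) ∧
        ∀ x : Fin n → ℤ, x ≠ 0 →
          ((∏ i, |∑ j, L i j * (x j : ℝ)|) * (∏ i, ‖∑ j, M i j * (x j : PadicAlgCl p)‖)) ^ q *
              ((Finset.univ.sup fun j => (x j).natAbs : ℕ) : ℝ) < 1 →
            ∃ f ∈ T, ∑ j, f j * (x j : ℚ) = 0 := by
  intro n hn p _ L M hLa hMa hLi hMi q hq
  classical
  -- the data of the fact: `S = {∞, p}`, the real forms read in `ℂ`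
  set L' : Fin n → Fin n → ℂ := fun i j => (L i j : ℂ) with hL'
  have hL'a : ∀ i j, IsAlgebraic ℚ (L' i j) := fun i j => by
    simpa [hL', Complex.coe_algebraMap] using (hLa i j).algebraMap (A := ℂ)
  have hL'i : LinearIndependent ℂ L' := linearIndependent_complex_of_real hLi
  haveI : ∀ k : PUnit, Fact ((fun _ : PUnit => p) k).Prime := fun _ => inferInstance
  have hq0 : (q : ℝ) ≠ 0 := by exact_mod_cast (by omega : q ≠ 0)
  have hε : (0 : ℝ) < 1 / q := by positivity
  obtain ⟨T, hT0, hT⟩ := h.hyperplanes n hn PUnit (fun _ => p)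
    (fun _ _ _ => Subsingleton.elim _ _) L' hL'a hL'i (fun _ => M) (fun _ => hMa) (fun _ => hMi)
    (1 / q) hε
  refine ⟨T, hT0, fun x hx hlt => hT x hx ?_⟩
  -- the inequality `P^q · ‖x‖ < 1` gives `P ≤ ‖x‖^{-1/q}`
  have hnormL : ∀ i, ‖∑ j, L' i j * (x j : ℂ)‖ = |∑ j, L i j * (x j : ℝ)| := by
    intro i
    have : (∑ j, L' i j * (x j : ℂ)) = ((∑ j, L i j * (x j : ℝ) : ℝ) : ℂ) := by
      push_cast [hL']
      rfl
    rw [this, Complex.norm_real, Real.norm_eq_abs]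
  simp only [hnormL, Fintype.prod_unique]
  set P : ℝ := (∏ i, |∑ j, L i j * (x j : ℝ)|) * ∏ i, ‖∑ j, M i j * (x j : PadicAlgCl p)‖ with hP
  set N : ℝ := ((Finset.univ.sup fun j => (x j).natAbs : ℕ) : ℝ) with hN
  have hP0 : 0 ≤ P := mul_nonneg (Finset.prod_nonneg fun i _ => abs_nonneg _)
    (Finset.prod_nonneg fun i _ => norm_nonneg _)
  have hN1 : 1 ≤ N := one_le_sup_natAbs_of_ne_zero hx
  have hN0 : 0 < N := one_pos.trans_le hN1
  have h1 : P ^ q < N⁻¹ := by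
    rw [← one_div, lt_div_iff₀ hN0]; exact hlt
  have h2 : P < (N⁻¹) ^ ((q : ℝ)⁻¹) := by
    calc P = (P ^ q) ^ ((q : ℝ)⁻¹) := (Real.pow_rpow_inv_natCast hP0 (by omega)).symm
      _ < (N⁻¹) ^ ((q : ℝ)⁻¹) := Real.rpow_lt_rpow (pow_nonneg hP0 q) h1 (by positivity)
  have h3 : (N⁻¹) ^ ((q : ℝ)⁻¹) = N ^ (-(1 / (q : ℝ))) := by
    rw [Real.rpow_neg hN0.le, Real.inv_rpow hN0.le, one_div]
  exact (h2.trans_eq h3).le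

/-- **The case `S = {∞}`: Schmidt's Subspace Theorem** in the shape of Bilu Thm. 2.2 / Evertse–Győry
Thm. 3.1.2 (hyperplane form): for `m ≥ 2` and `m` linearly independent linear forms `L_i` with
coefficients in `ℂ` algebraic over `ℚ`, and `ε > 0`, there is a finite set `T` of non-zero rational
linear forms such that every `x ∈ ℤ^m ∖ {0}` with `|L_1(x) ⋯ L_m(x)| ≤ ‖x‖^{-ε}` satisfies `f(x) = 0`
for some `f ∈ T`.  From `Schlickewei1976_padicSubspaceTheorem` with no finite prime.
[cite: Bilu2008, Thm. 2.2 and Thm. 2.3 (p. 967-04)] [cite: EvertseGyory2015, Thm. 3.1.2 (PDF pp. 50–51)] -/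
theorem Schlickewei1976_padicSubspaceTheorem.schmidt (h : Schlickewei1976_padicSubspaceTheorem) :
    ∀ (m : ℕ), 2 ≤ m → ∀ (L : Fin m → Fin m → ℂ), (∀ i j, IsAlgebraic ℚ (L i j)) → LinearIndependent ℂ L →
    ∀ ε : ℝ, 0 < ε →
      ∃ T : Finset (Fin m → ℚ), (∀ f ∈ T, f ≠ 0) ∧
        ∀ x : Fin m → ℤ, x ≠ 0 →
          (∏ i, ‖∑ j, L i j * (x j : ℂ)‖) ≤ (((Finset.univ.sup fun j => (x j).natAbs : ℕ) : ℝ)) ^ (-ε) →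
          ∃ f ∈ T, ∑ j, f j * (x j : ℚ) = 0 := by
  intro m hm L hLa hLi ε hε
  haveI : ∀ k : PEmpty, Fact ((fun k : PEmpty => (PEmpty.elim k : ℕ)) k).Prime := fun k => PEmpty.elim k
  obtain ⟨T, hT0, hT⟩ := h.hyperplanes m hm PEmpty (fun k => PEmpty.elim k)
    (fun k => PEmpty.elim k) L hLa hLi (fun k => PEmpty.elim k) (fun k => PEmpty.elim k)
    (fun k => PEmpty.elim k) ε hε
  refine ⟨T, hT0, fun x hx hineq => hT x hx ?_⟩
  simpa using hineq

end Literature.NumberTheory.DiophantineApproximation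

end
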